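import Summits.QuantumFields.YangMills.Theorems.BalabanLadderNTN32VarianceDefs
import Summits.QuantumFields.YangMills.Theorems.InfiniteVolumeContinuumOnsetFloorsKOfAxialFloor
import HarnessLib

/-!
# Leaf `InfiniteVolumeContinuum.HypercubicOSDataFromInfiniteVolume` (stmt-QuantumFields-19868), stub N, part 6 —
# BY NAME: the NT line «n32-variance» stubs `N32T ∧ K3T` (crux `NT`, stmt-QuantumFields-19353; defs landed as
# `…BalabanLadderNTN32VarianceDefs`, namespace `NT.N32Floors`) give `LowerBoundsK`, the leaf's stub N `OnsetFloorsK`,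
# and the axial-ball floor (the weakest two-point input the composition uses)

Helper file (`--supports stmt-QuantumFields-19868`) of prover seat `ymfull-r2a-prover-1` (R590-ym item 13), co-ordinated
with `ymfull-r2a-plan-1` (line) and `ymfull-r2a-prover-2` (Defs module `N32Floors`), HOME `pub/ideators/ym-idea-2/STATUS.md`.
Parts 4–5 (`…OnsetFloorsKOfUniformFloors`, `…OnsetFloorsKOfAxialFloor`) proved everything with the floor statements
unbundled; this file is the by-name layer over the landed defs:

* `lowerBoundsK_of_n32Floors` — `N32Floors.UniformTwoPointFloor G r a → N32Floors.UniformThreePointFloor G r a →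
  LowerBoundsK G r a` (compact bump witnesses);
* `axialBallFloor_of_uniformTwoPointFloor` — `N32Floors.UniformTwoPointFloor G r a` ⇒ the axial-ball floor (∃-form), the
  weakest two-point consequence the composition `NT_of` consumes (part 5);
* `onsetFloorsK_of_n32T_k3T : N32T → K3T → OnsetFloorsK` — the leaf's registered stub N from the NT line's two stubs BY NAME;
* `nt_and_onsetFloorsK_of_n32T_k3T : N32T → K3T → BalabanLadder.NT ∧ OnsetFloorsK` — one engine bill, both residuals.

HONEST LABEL: CONDITIONAL reductions; `N32T` (Bałaban's N32 in NT letters, [Balaban1989LargeFieldII] p. 356, announced, not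
printed) and `K3T` are OPEN; nothing here proves a floor, `NT`, the leaf, any rung or summit; finite-volume / conditional
content only; the Yang–Mills mass gap is NOT proved.
-/

set_option autoImplicit false

noncomputable section

open scoped SchwartzMap
open MeasureTheory Filter Topology Metric
open Literature.MathematicalPhysics.QuantumFieldTheory Literature.MathematicalPhysics.QuantumLattice
open Literature.Probability.LatticeModels
open Summit.QuantumFields.YangMills.Cruxes.OSLegsFromFemtoAndGap.DlrCollarTransfer
open Summit.QuantumFields.YangMills.Cruxes.NT.N32Floors (UniformTwoPointFloor UniformThreePointFloor N32T K3T)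
open Summit.QuantumFields.YangMills.Cruxes.AtomicCalibrationR.MirrorCalibration
  (LowerBoundsK OnsetFloorsK lowerBounds_of_K)

namespace Summit.QuantumFields.YangMills.Cruxes.HypercubicOSDataFromInfiniteVolume.OnsetFloorsN

section ByName

variable (G : Type) [Group G] [TopologicalSpace G] [IsTopologicalGroup G] [CompactSpace G]
  [MeasurableSpace G] [BorelSpace G] (r : LatticeRep G)

/-- **`LowerBoundsK` from the NT line's two floors BY NAME** (`N32Floors.UniformTwoPointFloor`,
`N32Floors.UniformThreePointFloor` at the same `(r, a)`, `0 < a`, `a → 0`): compact bump witnesses (part 4). [folklore] -/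
theorem lowerBoundsK_of_n32Floors (a : ℝ → ℝ) (ha : ∀ β, 0 < a β) (ha0 : Tendsto a atTop (𝓝 0))
    (h2 : UniformTwoPointFloor G r a) (h3 : UniformThreePointFloor G r a) : LowerBoundsK G r a :=
  lowerBoundsK_of_uniformFloors G r a ha ha0 h2 h3

/-- **The isotropic window floor of the line yields the axial-ball floor** (the weakest two-point input the composition
uses, part 5): `N32Floors.UniformTwoPointFloor G r a` ⇒ `∃ ν > 0, 0 < R < T, β₅, Λ₅` with `ν·a(β)⁸ ≤ Cov_T(A_x, A_y)`
for every pair whose physical separation vector lies in `B̄(T·e₀, R)`. [folklore] -/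
theorem axialBallFloor_of_uniformTwoPointFloor (a : ℝ → ℝ) (ha : ∀ β, 0 < a β) (h2 : UniformTwoPointFloor G r a) :
    ∃ ν T R β₅ Λ₅ : ℝ, 0 < ν ∧ 0 < R ∧ R < T ∧
      ∀ β : ℝ, β₅ ≤ β → ∀ L : ℕ, Λ₅ ≤ a β * L → ∀ x ∈ box 4 L, ∀ y ∈ box 4 L,
        dist (a β • siteToE (y - x)) (EuclideanSpace.single 0 T) ≤ R →
          ν * a β ^ 8 ≤ torusE G r β L (fun U => dens G r x U * dens G r y U) -
            torusE G r β L (dens G r x) * torusE G r β L (dens G r y) := by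
  obtain ⟨ν, s₀, s₁, β₅, Λ₅, hν, hs₀, hs₀₁, hfl⟩ := h2
  exact ⟨ν, (s₀ + s₁) / 2, (s₁ - s₀) / 4, β₅, Λ₅, hν, by linarith, by linarith,
    axialBallFloor_of_windowFloor G r a hs₀ hs₀₁ hfl ha⟩

end ByName

/-- **The leaf's stub N from the NT line's stubs BY NAME**: `N32T → K3T → OnsetFloorsK` (for each SU(2)-class `G`,
`N32T` gives `(r, a)` with the window floor, `K3T` the cloud floor in the same units; part 4 gives `LowerBoundsK`,
part 2 the onset floors with resolution `s := a β`). [folklore] -/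
theorem onsetFloorsK_of_n32T_k3T (h1 : N32T) (h2 : K3T) : OnsetFloorsK := by
  refine onsetFloorsK_of_lowerBoundsK fun G _ _ _ _ hG _ => ?_
  letI : MeasurableSpace G := borel G
  haveI : BorelSpace G := ⟨rfl⟩
  obtain ⟨r, a, ha, ha0, hfl2⟩ := h1 G hG
  exact ⟨r, a, ha, ha0, lowerBoundsK_of_n32Floors G r a ha ha0 hfl2 (h2 G hG r a ha ha0 hfl2)⟩

/-- **One engine bill, two residuals**: the NT line's stubs `N32T ∧ K3T` give BOTH the spine's crux `BalabanLadder.NT`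
(the line's `NT_of`; here through `LowerBoundsK` and `lowerBounds_of_K`) AND the leaf's stub N `OnsetFloorsK`.
[folklore] -/
theorem nt_and_onsetFloorsK_of_n32T_k3T (h1 : N32T) (h2 : K3T) :
    Summit.QuantumFields.YangMills.Theses.BalabanLadder.NT ∧ OnsetFloorsK := by
  refine ⟨fun G _ _ _ _ hG => ?_, onsetFloorsK_of_n32T_k3T h1 h2⟩
  letI : MeasurableSpace G := borel G
  haveI : BorelSpace G := ⟨rfl⟩
  obtain ⟨r, a, ha, ha0, hfl2⟩ := h1 G hG
  exact ⟨r, a, ha, ha0, lowerBounds_of_K (lowerBoundsK_of_n32Floors G r a ha ha0 hfl2 (h2 G hG r a ha ha0 hfl2))⟩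

end Summit.QuantumFields.YangMills.Cruxes.HypercubicOSDataFromInfiniteVolume.OnsetFloorsN

end
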